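import Mathlib
import Summits.PneNP.PneNP.Theorems.PstarExpandingCount
import Summits.PneNP.PneNP.Theorems.PstarSASDPLevel

/-!
# Random typed `P⋆` instances at boundary ratio `7/4`, I: the union bound (w23d supply, counting)

FRONTIER range-avoidance ladder (cell `pnp-ideate`, residue w23d of ROUNDS 21–23; restricted-model combinatorics — nothing here
bears on `P` versus `NP`).

The SA+SDP hubs `PstarSASDPLevel.TypedSASDPLinearLevel` (T21.1c) and `PairwiseSA.pairwiseSASDPLinearLevel` (T23.3) need boundary
ratio `7/4` (`BoundaryExpandingQ 7 4`) — the R21 existence theorem `PstarExpandingExist.expandingTypedExist'` delivers `3/2`.  This is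
the `7/4` re-run of `PstarExpandingCount` in the SAME model `PstarExpandingModel.Outcome N m` (so that the alteration step for simple
overlaps, `PstarOverlapCount`, composes over one outcome space): an outcome is `bad74` at radius `r` if some `≤ r` outputs `J` have
`8·|N(J)| < 23·|J|`; otherwise `2|N(J)| ≤ |bdry J| + 4|J|` gives `|bdry J| ≥ (7/4)|J|` (`boundaryExpandingQ74_of_not_bad74`).  The bad
sets of size `s` read at most `v74 s = ⌊(23s − 1)/8⌋` variables (slack `3s − v74 s ≥ (s+1)/8`), and the cylinders / pair counts /
product counts of `PstarExpandingCount` are reused verbatim: `card_badSet74_le` is the union bound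
`|bad74| ≤ Σ_{s ≤ r} C(m,s)·C(2N, v74 s)·(v74 s⁴/16)^s·Q^{m−s}`.  SCOPE: arity `k = 4` only (the `k = 6` hub gate needs `15/4`, w23e).
-/

set_option linter.dupNamespace false -- `Summit.PneNP.PneNP.…`: summit = sub-problem name (D-0017 single-conjunct layout)

open Finset Literature.Computability.Complexity
open Summit.PneNP.PneNP.Theorems.PstarSALevel (varSet bdry)
open Summit.PneNP.PneNP.Theorems.PstarSAClosure (nbhd)
open Summit.PneNP.PneNP.Theorems.PstarSASDPLevel (BoundaryExpandingQ)
open Summit.PneNP.PneNP.Theorems.PstarExpandingModel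
open Summit.PneNP.PneNP.Theorems.PstarExpandingCount (cylJ mem_cylJ pairsOf card_pairsOf_le card_cylJ_le)

namespace Summit.PneNP.PneNP.Theorems.PstarExpanding74Count

variable {N m : ℕ}

/-! ## Bad outcomes at ratio `7/4` -/

/-- An outcome is BAD (ratio `7/4`) at radius `r` if some `≤ r` outputs read fewer than `23/8` variables each on average. -/
def bad74 (r : ℕ) (ω : Outcome N m) : Prop :=
  ∃ J : Finset (Fin m), J.card ≤ r ∧ ¬(23 * J.card ≤ 8 * (nbhd (inst ω) J).card)

/-- A good outcome gives an `(r, 7/4)`-boundary expanding instance. -/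
theorem boundaryExpandingQ74_of_not_bad74 (r : ℕ) (ω : Outcome N m) (h : ¬bad74 r ω) :
    BoundaryExpandingQ 7 4 r (inst ω) := by
  intro J hJ
  have h1 : 23 * J.card ≤ 8 * (nbhd (inst ω) J).card := by
    by_contra hlt
    exact h ⟨J, hJ, hlt⟩
  have h2 := two_card_nbhd_le (inst ω) (fun j => slots_injective (ω j)) J
  omega

/-- The threshold `v74 s = ⌊(23s − 1)/8⌋`: the largest `V` with `8V < 23s`. -/
def v74 (s : ℕ) : ℕ := (23 * s - 1) / 8

/-- A bad set of size `s` reads at most `v74 s` variables. -/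
theorem le_v74_of_lt {s V : ℕ} (h : ¬(23 * s ≤ 8 * V)) : V ≤ v74 s := by unfold v74; omega

/-- `v74 s ≤ 3s`. -/
theorem v74_le (s : ℕ) : v74 s ≤ 3 * s := by unfold v74; omega

/-- The slack: `s + 1 ≤ 8·(3s − v74 s)` for `s ≥ 1`. -/
theorem slack74 {s : ℕ} (hs : 1 ≤ s) : s + 1 ≤ 8 * (3 * s - v74 s) := by unfold v74; omega

/-- `1 ≤ v74 s` for `s ≥ 1`. -/
theorem one_le_v74 {s : ℕ} (hs : 1 ≤ s) : 1 ≤ v74 s := by unfold v74; omega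

/-! ## The containment of the bad set -/

/-- The bad outcomes. -/
noncomputable def badSet74 (N m r : ℕ) : Finset (Outcome N m) := by
  classical exact univ.filter fun ω => bad74 r ω

/-- The covering family: sizes `s = i + 1`, `i < r`, sets `J` of that size and pairs of total size `v74 s`. -/
def cover74 (N m r : ℕ) : Finset (Outcome N m) :=
  (Finset.range r).biUnion fun i => (univ.powersetCard (i + 1)).biUnion fun J =>
    (pairsOf N (v74 (i + 1))).biUnion fun AB => cylJ J AB.1 AB.2

/-- **Containment**: if `3r ≤ N`, every bad outcome lies in the cover. -/
theorem badSet74_subset (r : ℕ) (hr : 3 * r ≤ N) : badSet74 N m r ⊆ cover74 N m r := by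
  classical
  intro ω hω
  simp only [badSet74, Finset.mem_filter, Finset.mem_univ, true_and] at hω
  obtain ⟨J, hJr, hJ⟩ := hω
  have hs : 1 ≤ J.card := by
    rw [Nat.one_le_iff_ne_zero]
    intro h0
    rw [Finset.card_eq_zero] at h0
    subst h0
    exact hJ (by simp)
  have hV : (nbhd (inst ω) J).card ≤ v74 J.card := le_v74_of_lt hJ
  have hvN : v74 J.card ≤ N := (v74_le _).trans (by omega)
  obtain ⟨A, B, hAB, hmem⟩ := exists_pair_of_small_nbhd ω J (v74 J.card) hvN hV
  simp only [cover74, Finset.mem_biUnion, Finset.mem_range, Finset.mem_powersetCard]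
  refine ⟨J.card - 1, by omega, J, ⟨Finset.subset_univ _, by omega⟩, (A, B), ?_, ?_⟩
  · simp only [PstarExpandingCount.pairsOf, Finset.mem_filter, Finset.mem_univ, true_and]
    rw [hAB]; congr 1; omega
  · exact mem_cylJ.2 hmem

/-! ## The union bound -/

/-- **The union bound at ratio `7/4`.**  If `3r ≤ N` then
`|bad74| ≤ Σ_{i<r} C(m, i+1)·C(2N, v74(i+1))·(v74(i+1)⁴/16)^{i+1}·Q^{m−(i+1)}`. -/
theorem card_badSet74_le (r : ℕ) (hr : 3 * r ≤ N) :
    ((badSet74 N m r).card : ℝ) ≤ ∑ i ∈ Finset.range r,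
      (m.choose (i + 1) : ℝ) * ((N + N).choose (v74 (i + 1)) : ℝ) * ((v74 (i + 1) : ℝ) ^ 4 / 16) ^ (i + 1) *
        (Fintype.card (DPair N × DPair N) : ℝ) ^ (m - (i + 1)) := by
  classical
  have h0 : ((badSet74 N m r).card : ℝ) ≤ ((cover74 N m r).card : ℝ) := by
    exact_mod_cast Finset.card_le_card (badSet74_subset r hr)
  refine h0.trans ?_
  unfold cover74
  refine (Nat.cast_le.2 Finset.card_biUnion_le).trans ?_
  push_cast
  refine Finset.sum_le_sum fun i _ => ?_
  refine (Nat.cast_le (α := ℝ).2 Finset.card_biUnion_le).trans ?_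
  push_cast
  have hJ : ∀ J ∈ (univ : Finset (Fin m)).powersetCard (i + 1),
      (((pairsOf N (v74 (i + 1))).biUnion fun AB => cylJ J AB.1 AB.2).card : ℝ) ≤
        ((N + N).choose (v74 (i + 1)) : ℝ) * ((v74 (i + 1) : ℝ) ^ 4 / 16) ^ (i + 1) *
          (Fintype.card (DPair N × DPair N) : ℝ) ^ (m - (i + 1)) := by
    intro J hJ
    rw [Finset.mem_powersetCard] at hJ
    refine (Nat.cast_le (α := ℝ).2 Finset.card_biUnion_le).trans ?_
    push_cast
    have hterm : ∀ AB ∈ pairsOf N (v74 (i + 1)), ((cylJ J AB.1 AB.2).card : ℝ) ≤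
        ((v74 (i + 1) : ℝ) ^ 4 / 16) ^ (i + 1) * (Fintype.card (DPair N × DPair N) : ℝ) ^ (m - (i + 1)) := by
      intro AB hAB
      simp only [PstarExpandingCount.pairsOf, Finset.mem_filter, Finset.mem_univ, true_and] at hAB
      have := card_cylJ_le (m := m) J hAB
      rwa [hJ.2] at this
    refine (Finset.sum_le_sum hterm).trans ?_
    rw [Finset.sum_const, nsmul_eq_mul]
    have hp : ((pairsOf N (v74 (i + 1))).card : ℝ) ≤ ((N + N).choose (v74 (i + 1)) : ℝ) := by
      exact_mod_cast card_pairsOf_le N (v74 (i + 1))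
    have hnn : (0 : ℝ) ≤ ((v74 (i + 1) : ℝ) ^ 4 / 16) ^ (i + 1) *
        (Fintype.card (DPair N × DPair N) : ℝ) ^ (m - (i + 1)) := by positivity
    nlinarith
  refine (Finset.sum_le_sum hJ).trans ?_
  have hc : ((univ : Finset (Fin m)).powersetCard (i + 1)).card = m.choose (i + 1) := by
    rw [Finset.card_powersetCard, Finset.card_univ, Fintype.card_fin]
  rw [Finset.sum_const, nsmul_eq_mul, hc]
  exact le_of_eq (by ring)

end Summit.PneNP.PneNP.Theorems.PstarExpanding74Count
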